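import Summits.QuantumFields.YangMills.Theorems.ToronSmallBallOwnAxisShiftNumerics
import HarnessLib

/-!
# The seam-axis sheet shift: the numeric inequalities of the periodic-sector core estimate hold for large `β`

Support module (`--supports` stmt-QuantumFields-23948, `QuantileBitPurity.HolonomyQuantileSubQuartic`; seat ym-dw-p1 g16).  Pure real-variable
bookkeeping, no lattice object.  For a window exponent `0 < a ≤ 1/400` put `θ = 2β^(−2/5)` (shift angle), `χ = β^(−1/4)` (non-centrality thresholds of
the axis rule), `η = β^(−19/40)` (closeness scale of the good-field event).  Then there is `β₀(a)` such that for every `β ≥ β₀` and every natural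
`1 ≤ L ≤ β^a` the four hypotheses of `GAxis.sectorWeight_core_le_of_numerics` hold (★ `gaxis_numerics_of_le`): `200 ≤ β`, `θ ≤ 1`, the cost
inequality `3βL⁴(D² + 2Dη + D_g² + 2D_gη) ≤ 1` with `D = θ(2L²η/χ + 2χ + 2L²η + 2Lη) ≤ 16L²β^(−5/8)`, `D_g = θ(2χ + 4L²η) ≤ 12L²β^(−13/20)`
(the four resulting monomials are `β^(8a−1/4)`, `β^(6a−1/10)`, `β^(8a−3/10)`, `β^(6a−1/8)` up to constants), and the bad-field inequality of
`OwnAxis.ineq_bad` (reused verbatim).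

HONEST FRAMING: elementary real analysis; nothing about lattice gauge theory.  No `sorry`, no new axiom, no new definition.  References: [folklore].
-/

set_option autoImplicit false

noncomputable section

open Real

namespace Summit.QuantumFields.YangMills.Theorems.FemtoTransferGap.GAxis

open OwnAxis

section Ineq

variable {a β : ℝ} {L : ℕ}

/-- (N2) the shift angle is at most `1`: `2β^{−2/5} ≤ 1` for `β ≥ 2^{5/2}`. [folklore] -/
theorem ineq_theta (hβ : (2 : ℝ) ^ (1 / (-(-(2 / 5 : ℝ)))) ≤ β) : 2 * β ^ (-(2 / 5 : ℝ)) ≤ 1 :=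
  mul_rpow_le_one_of_le (by norm_num) (by norm_num) hβ

/-- The edge-defect bound `D ≤ 16 L² β^{−5/8}` (`β ≥ 1`, `L ≥ 1`). [folklore] -/
theorem D_le (hβ1 : 1 ≤ β) (hL1 : 1 ≤ L) :
    (2 * β ^ (-(2 / 5 : ℝ))) * (2 * (L * (L * β ^ (-(19 / 40 : ℝ)))) / β ^ (-(1 / 4 : ℝ)) + 2 * β ^ (-(1 / 4 : ℝ)) +
        2 * (L * (L * β ^ (-(19 / 40 : ℝ)))) + 2 * (L * β ^ (-(19 / 40 : ℝ)))) ≤ 16 * (L : ℝ) ^ 2 * β ^ (-(5 / 8 : ℝ)) := by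
  have hβ0 : 0 < β := by linarith
  have hLr : (1 : ℝ) ≤ L := by exact_mod_cast hL1
  have hL2 : (L : ℝ) ≤ (L : ℝ) ^ 2 := by nlinarith
  have hL21 : (1 : ℝ) ≤ (L : ℝ) ^ 2 := by nlinarith
  set g : ℝ := β ^ (-(9 / 40 : ℝ)) with hg
  have hg0 : 0 < g := Real.rpow_pos_of_pos hβ0 _
  have hx0 : 0 < β ^ (-(2 / 5 : ℝ)) := Real.rpow_pos_of_pos hβ0 _
  -- the four terms are each `≤ 2 L² g`
  have hquot : β ^ (-(19 / 40 : ℝ)) / β ^ (-(1 / 4 : ℝ)) = g := by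
    rw [hg, ← Real.rpow_sub hβ0]; norm_num
  have hχ : β ^ (-(1 / 4 : ℝ)) ≤ g := Real.rpow_le_rpow_of_exponent_le hβ1 (by norm_num)
  have hη : β ^ (-(19 / 40 : ℝ)) ≤ g := Real.rpow_le_rpow_of_exponent_le hβ1 (by norm_num)
  have h1 : 2 * ((L : ℝ) * (L * β ^ (-(19 / 40 : ℝ)))) / β ^ (-(1 / 4 : ℝ)) = 2 * (L : ℝ) ^ 2 * g := by
    rw [← hquot]; ring
  have h2 : 2 * β ^ (-(1 / 4 : ℝ)) ≤ 2 * (L : ℝ) ^ 2 * g := by nlinarith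
  have h3 : 2 * ((L : ℝ) * (L * β ^ (-(19 / 40 : ℝ)))) ≤ 2 * (L : ℝ) ^ 2 * g := by nlinarith
  have h4 : 2 * ((L : ℝ) * β ^ (-(19 / 40 : ℝ))) ≤ 2 * (L : ℝ) ^ 2 * g := by
    have : (L : ℝ) * β ^ (-(19 / 40 : ℝ)) ≤ (L : ℝ) ^ 2 * g := mul_le_mul hL2 hη (by positivity) (by positivity)
    linarith
  have hsum : 2 * ((L : ℝ) * (L * β ^ (-(19 / 40 : ℝ)))) / β ^ (-(1 / 4 : ℝ)) + 2 * β ^ (-(1 / 4 : ℝ)) +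
      2 * (L * (L * β ^ (-(19 / 40 : ℝ)))) + 2 * (L * β ^ (-(19 / 40 : ℝ))) ≤ 8 * (L : ℝ) ^ 2 * g := by rw [h1]; linarith
  have hprod : β ^ (-(2 / 5 : ℝ)) * g = β ^ (-(5 / 8 : ℝ)) := by rw [hg, ← Real.rpow_add hβ0]; norm_num
  calc (2 * β ^ (-(2 / 5 : ℝ))) * (2 * (L * (L * β ^ (-(19 / 40 : ℝ)))) / β ^ (-(1 / 4 : ℝ)) + 2 * β ^ (-(1 / 4 : ℝ)) +
        2 * (L * (L * β ^ (-(19 / 40 : ℝ)))) + 2 * (L * β ^ (-(19 / 40 : ℝ))))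
      ≤ (2 * β ^ (-(2 / 5 : ℝ))) * (8 * (L : ℝ) ^ 2 * g) := mul_le_mul_of_nonneg_left hsum (by positivity)
    _ = 16 * (L : ℝ) ^ 2 * (β ^ (-(2 / 5 : ℝ)) * g) := by ring
    _ = 16 * (L : ℝ) ^ 2 * β ^ (-(5 / 8 : ℝ)) := by rw [hprod]

/-- The seam-defect bound `D_g ≤ 12 L² β^{−13/20}` (`β ≥ 1`, `L ≥ 1`). [folklore] -/
theorem Dg_le (hβ1 : 1 ≤ β) (hL1 : 1 ≤ L) :
    (2 * β ^ (-(2 / 5 : ℝ))) * (2 * β ^ (-(1 / 4 : ℝ)) + 4 * (L * (L * β ^ (-(19 / 40 : ℝ))))) ≤ 12 * (L : ℝ) ^ 2 * β ^ (-(13 / 20 : ℝ)) := by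
  have hβ0 : 0 < β := by linarith
  have hLr : (1 : ℝ) ≤ L := by exact_mod_cast hL1
  have hL21 : (1 : ℝ) ≤ (L : ℝ) ^ 2 := by nlinarith
  have hχ0 : 0 < β ^ (-(1 / 4 : ℝ)) := Real.rpow_pos_of_pos hβ0 _
  have hη : β ^ (-(19 / 40 : ℝ)) ≤ β ^ (-(1 / 4 : ℝ)) := Real.rpow_le_rpow_of_exponent_le hβ1 (by norm_num)
  have hsum : 2 * β ^ (-(1 / 4 : ℝ)) + 4 * ((L : ℝ) * (L * β ^ (-(19 / 40 : ℝ)))) ≤ 6 * (L : ℝ) ^ 2 * β ^ (-(1 / 4 : ℝ)) := by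
    have h1 : 2 * β ^ (-(1 / 4 : ℝ)) ≤ 2 * (L : ℝ) ^ 2 * β ^ (-(1 / 4 : ℝ)) := by nlinarith
    have h2 : (L : ℝ) * (L * β ^ (-(19 / 40 : ℝ))) ≤ (L : ℝ) ^ 2 * β ^ (-(1 / 4 : ℝ)) := by
      rw [← mul_assoc, ← sq]; exact mul_le_mul_of_nonneg_left hη (by positivity)
    linarith
  have hprod : β ^ (-(2 / 5 : ℝ)) * β ^ (-(1 / 4 : ℝ)) = β ^ (-(13 / 20 : ℝ)) := by rw [← Real.rpow_add hβ0]; norm_num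
  calc (2 * β ^ (-(2 / 5 : ℝ))) * (2 * β ^ (-(1 / 4 : ℝ)) + 4 * (L * (L * β ^ (-(19 / 40 : ℝ)))))
      ≤ (2 * β ^ (-(2 / 5 : ℝ))) * (6 * (L : ℝ) ^ 2 * β ^ (-(1 / 4 : ℝ))) := mul_le_mul_of_nonneg_left hsum (by positivity)
    _ = 12 * (L : ℝ) ^ 2 * (β ^ (-(2 / 5 : ℝ)) * β ^ (-(1 / 4 : ℝ))) := by ring
    _ = 12 * (L : ℝ) ^ 2 * β ^ (-(13 / 20 : ℝ)) := by rw [hprod]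

/-- Monotonicity of `x ↦ x² + 2xη` on `x ≥ 0` (local copy). [folklore] -/
theorem sq_add_two_mul_mono {x y η : ℝ} (hx : 0 ≤ x) (hxy : x ≤ y) (hη : 0 ≤ η) : x ^ 2 + 2 * x * η ≤ y ^ 2 + 2 * y * η := by nlinarith

/-- (N3) the cost inequality `3βL⁴(D² + 2Dη + D_g² + 2D_gη) ≤ 1`. [folklore] -/
theorem ineq_costQ (ha : 0 < a) (ha' : a ≤ 1 / 400) (hβ1 : 1 ≤ β) (hL1 : 1 ≤ L) (hL : (L : ℝ) ≤ β ^ a)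
    (hβa : (3072 : ℝ) ^ (1 / (-(8 * a - 1 / 4))) ≤ β) (hβb : (384 : ℝ) ^ (1 / (-(6 * a - 1 / 10))) ≤ β)
    (hβc : (1728 : ℝ) ^ (1 / (-(8 * a - 3 / 10))) ≤ β) (hβd : (288 : ℝ) ^ (1 / (-(6 * a - 1 / 8))) ≤ β) :
    3 * β * (L : ℝ) ^ 4 *
        (((2 * β ^ (-(2 / 5 : ℝ))) * (2 * (L * (L * β ^ (-(19 / 40 : ℝ)))) / β ^ (-(1 / 4 : ℝ)) + 2 * β ^ (-(1 / 4 : ℝ)) +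
              2 * (L * (L * β ^ (-(19 / 40 : ℝ)))) + 2 * (L * β ^ (-(19 / 40 : ℝ))))) ^ 2 +
          2 * ((2 * β ^ (-(2 / 5 : ℝ))) * (2 * (L * (L * β ^ (-(19 / 40 : ℝ)))) / β ^ (-(1 / 4 : ℝ)) + 2 * β ^ (-(1 / 4 : ℝ)) +
              2 * (L * (L * β ^ (-(19 / 40 : ℝ)))) + 2 * (L * β ^ (-(19 / 40 : ℝ))))) * β ^ (-(19 / 40 : ℝ)) +
          ((2 * β ^ (-(2 / 5 : ℝ))) * (2 * β ^ (-(1 / 4 : ℝ)) + 4 * (L * (L * β ^ (-(19 / 40 : ℝ)))))) ^ 2 +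
          2 * ((2 * β ^ (-(2 / 5 : ℝ))) * (2 * β ^ (-(1 / 4 : ℝ)) + 4 * (L * (L * β ^ (-(19 / 40 : ℝ)))))) * β ^ (-(19 / 40 : ℝ))) ≤ 1 := by
  have hβ0 : 0 < β := by linarith
  have hL0 : (0 : ℝ) ≤ L := Nat.cast_nonneg L
  set η : ℝ := β ^ (-(19 / 40 : ℝ)) with hη
  have hη0 : 0 ≤ η := (Real.rpow_pos_of_pos hβ0 _).le
  set D : ℝ := (2 * β ^ (-(2 / 5 : ℝ))) * (2 * (L * (L * η)) / β ^ (-(1 / 4 : ℝ)) + 2 * β ^ (-(1 / 4 : ℝ)) + 2 * (L * (L * η)) + 2 * (L * η)) with hD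
  set Dg : ℝ := (2 * β ^ (-(2 / 5 : ℝ))) * (2 * β ^ (-(1 / 4 : ℝ)) + 4 * (L * (L * η))) with hDg
  set u : ℝ := 16 * (L : ℝ) ^ 2 * β ^ (-(5 / 8 : ℝ)) with hu
  set v : ℝ := 12 * (L : ℝ) ^ 2 * β ^ (-(13 / 20 : ℝ)) with hv
  have hD0 : 0 ≤ D := by rw [hD]; positivity
  have hDg0 : 0 ≤ Dg := by rw [hDg]; positivity
  have hDu : D ≤ u := D_le hβ1 hL1
  have hDgv : Dg ≤ v := Dg_le hβ1 hL1
  have hmono1 := sq_add_two_mul_mono hD0 hDu hη0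
  have hmono2 := sq_add_two_mul_mono hDg0 hDgv hη0
  -- powers of `L`
  have hL6 : (L : ℝ) ^ 6 ≤ β ^ ((6 : ℕ) * a) := pow_le_rpow_mul hβ0.le hL0 hL 6
  have hL8 : (L : ℝ) ^ 8 ≤ β ^ ((8 : ℕ) * a) := pow_le_rpow_mul hβ0.le hL0 hL 8
  -- the four monomials
  have key1 : 3072 * β ^ (8 * a - 1 / 4) ≤ 1 := mul_rpow_le_one_of_le (by norm_num) (by linarith) hβa
  have key2 : 384 * β ^ (6 * a - 1 / 10) ≤ 1 := mul_rpow_le_one_of_le (by norm_num) (by linarith) hβb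
  have key3 : 1728 * β ^ (8 * a - 3 / 10) ≤ 1 := mul_rpow_le_one_of_le (by norm_num) (by linarith) hβc
  have key4 : 288 * β ^ (6 * a - 1 / 8) ≤ 1 := mul_rpow_le_one_of_le (by norm_num) (by linarith) hβd
  have hs1 : β ^ (8 * a - 1 / 4) = β * β ^ ((8 : ℕ) * a) * (β ^ (-(5 / 8 : ℝ))) ^ 2 := by
    rw [← Real.rpow_natCast (β ^ (-(5 / 8 : ℝ))) 2, ← Real.rpow_mul hβ0.le]
    nth_rw 2 [← Real.rpow_one β]
    rw [← Real.rpow_add hβ0, ← Real.rpow_add hβ0]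
    congr 1; push_cast; ring
  have hs2 : β ^ (6 * a - 1 / 10) = β * β ^ ((6 : ℕ) * a) * β ^ (-(5 / 8 : ℝ)) * η := by
    rw [hη]
    nth_rw 2 [← Real.rpow_one β]
    rw [← Real.rpow_add hβ0, ← Real.rpow_add hβ0, ← Real.rpow_add hβ0]
    congr 1; push_cast; ring
  have hs3 : β ^ (8 * a - 3 / 10) = β * β ^ ((8 : ℕ) * a) * (β ^ (-(13 / 20 : ℝ))) ^ 2 := by
    rw [← Real.rpow_natCast (β ^ (-(13 / 20 : ℝ))) 2, ← Real.rpow_mul hβ0.le]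
    nth_rw 2 [← Real.rpow_one β]
    rw [← Real.rpow_add hβ0, ← Real.rpow_add hβ0]
    congr 1; push_cast; ring
  have hs4 : β ^ (6 * a - 1 / 8) = β * β ^ ((6 : ℕ) * a) * β ^ (-(13 / 20 : ℝ)) * η := by
    rw [hη]
    nth_rw 2 [← Real.rpow_one β]
    rw [← Real.rpow_add hβ0, ← Real.rpow_add hβ0, ← Real.rpow_add hβ0]
    congr 1; push_cast; ring
  have hb58 : 0 ≤ β ^ (-(5 / 8 : ℝ)) := (Real.rpow_pos_of_pos hβ0 _).le
  have hb1320 : 0 ≤ β ^ (-(13 / 20 : ℝ)) := (Real.rpow_pos_of_pos hβ0 _).le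
  have ht1 : 3 * β * (L : ℝ) ^ 4 * u ^ 2 ≤ 1 / 4 := by
    have e : 3 * β * (L : ℝ) ^ 4 * u ^ 2 = 768 * (β * (L : ℝ) ^ 8 * (β ^ (-(5 / 8 : ℝ))) ^ 2) := by rw [hu]; ring
    rw [e]
    have h : β * (L : ℝ) ^ 8 * (β ^ (-(5 / 8 : ℝ))) ^ 2 ≤ β * β ^ ((8 : ℕ) * a) * (β ^ (-(5 / 8 : ℝ))) ^ 2 := by gcongr
    rw [← hs1] at h
    linarith
  have ht2 : 3 * β * (L : ℝ) ^ 4 * (2 * u * η) ≤ 1 / 4 := by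
    have e : 3 * β * (L : ℝ) ^ 4 * (2 * u * η) = 96 * (β * (L : ℝ) ^ 6 * β ^ (-(5 / 8 : ℝ)) * η) := by rw [hu]; ring
    rw [e]
    have h : β * (L : ℝ) ^ 6 * β ^ (-(5 / 8 : ℝ)) * η ≤ β * β ^ ((6 : ℕ) * a) * β ^ (-(5 / 8 : ℝ)) * η := by gcongr
    rw [← hs2] at h
    linarith
  have ht3 : 3 * β * (L : ℝ) ^ 4 * v ^ 2 ≤ 1 / 4 := by
    have e : 3 * β * (L : ℝ) ^ 4 * v ^ 2 = 432 * (β * (L : ℝ) ^ 8 * (β ^ (-(13 / 20 : ℝ))) ^ 2) := by rw [hv]; ring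
    rw [e]
    have h : β * (L : ℝ) ^ 8 * (β ^ (-(13 / 20 : ℝ))) ^ 2 ≤ β * β ^ ((8 : ℕ) * a) * (β ^ (-(13 / 20 : ℝ))) ^ 2 := by gcongr
    rw [← hs3] at h
    linarith
  have ht4 : 3 * β * (L : ℝ) ^ 4 * (2 * v * η) ≤ 1 / 4 := by
    have e : 3 * β * (L : ℝ) ^ 4 * (2 * v * η) = 72 * (β * (L : ℝ) ^ 6 * β ^ (-(13 / 20 : ℝ)) * η) := by rw [hv]; ring
    rw [e]
    have h : β * (L : ℝ) ^ 6 * β ^ (-(13 / 20 : ℝ)) * η ≤ β * β ^ ((6 : ℕ) * a) * β ^ (-(13 / 20 : ℝ)) * η := by gcongr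
    rw [← hs4] at h
    linarith
  have hβL : 0 ≤ 3 * β * (L : ℝ) ^ 4 := by positivity
  calc 3 * β * (L : ℝ) ^ 4 * (D ^ 2 + 2 * D * η + Dg ^ 2 + 2 * Dg * η)
      ≤ 3 * β * (L : ℝ) ^ 4 * (u ^ 2 + 2 * u * η + (v ^ 2 + 2 * v * η)) := by
        refine mul_le_mul_of_nonneg_left ?_ hβL; linarith
    _ = 3 * β * (L : ℝ) ^ 4 * u ^ 2 + 3 * β * (L : ℝ) ^ 4 * (2 * u * η) + 3 * β * (L : ℝ) ^ 4 * v ^ 2 + 3 * β * (L : ℝ) ^ 4 * (2 * v * η) := by ring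
    _ ≤ 1 / 4 + 1 / 4 + 1 / 4 + 1 / 4 := by linarith
    _ = 1 := by norm_num

end Ineq

/-! ## All at once -/

/-- ★ **All numeric hypotheses of the periodic-sector core estimate hold for large `β`.** [folklore] -/
theorem gaxis_numerics_of_le {a : ℝ} (ha : 0 < a) (ha' : a ≤ 1 / 400) :
    ∃ β₀ : ℝ, ∀ β : ℝ, β₀ ≤ β → ∀ L : ℕ, 1 ≤ L → (L : ℝ) ≤ β ^ a →
      200 ≤ β ∧ 2 * β ^ (-(2 / 5 : ℝ)) ≤ 1 ∧
      3 * β * (L : ℝ) ^ 4 *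
        (((2 * β ^ (-(2 / 5 : ℝ))) * (2 * (L * (L * β ^ (-(19 / 40 : ℝ)))) / β ^ (-(1 / 4 : ℝ)) + 2 * β ^ (-(1 / 4 : ℝ)) +
              2 * (L * (L * β ^ (-(19 / 40 : ℝ)))) + 2 * (L * β ^ (-(19 / 40 : ℝ))))) ^ 2 +
          2 * ((2 * β ^ (-(2 / 5 : ℝ))) * (2 * (L * (L * β ^ (-(19 / 40 : ℝ)))) / β ^ (-(1 / 4 : ℝ)) + 2 * β ^ (-(1 / 4 : ℝ)) +
              2 * (L * (L * β ^ (-(19 / 40 : ℝ)))) + 2 * (L * β ^ (-(19 / 40 : ℝ))))) * β ^ (-(19 / 40 : ℝ)) +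
          ((2 * β ^ (-(2 / 5 : ℝ))) * (2 * β ^ (-(1 / 4 : ℝ)) + 4 * (L * (L * β ^ (-(19 / 40 : ℝ)))))) ^ 2 +
          2 * ((2 * β ^ (-(2 / 5 : ℝ))) * (2 * β ^ (-(1 / 4 : ℝ)) + 4 * (L * (L * β ^ (-(19 / 40 : ℝ)))))) * β ^ (-(19 / 40 : ℝ))) ≤ 1 ∧
      4 * (L : ℝ) * Real.exp (-(β * (β ^ (-(19 / 40 : ℝ))) ^ 2 / 2)) * (β ^ (315 * L ^ 3)) ^ (2 * L) ≤ β ^ (-a) / 2 := by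
  refine ⟨max (max (max 200 ((2 : ℝ) ^ (1 / (-(-(2 / 5 : ℝ)))))) (max ((3072 : ℝ) ^ (1 / (-(8 * a - 1 / 4)))) ((384 : ℝ) ^ (1 / (-(6 * a - 1 / 10))))))
    (max (max ((1728 : ℝ) ^ (1 / (-(8 * a - 3 / 10)))) ((288 : ℝ) ^ (1 / (-(6 * a - 1 / 8))))) ((126206 : ℝ) ^ (1 / (-(-(3 / 100 : ℝ)))))),
    fun β hβ L hL1 hL => ?_⟩
  simp only [max_le_iff] at hβ
  obtain ⟨⟨⟨h200, h2⟩, h3072, h384⟩, ⟨h1728, h288⟩, h126⟩ := hβ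
  have hβ1 : 1 ≤ β := by linarith
  exact ⟨h200, ineq_theta h2, ineq_costQ ha ha' hβ1 hL1 hL h3072 h384 h1728 h288, ineq_bad ha ha' hβ1 hL h126⟩

end Summit.QuantumFields.YangMills.Theorems.FemtoTransferGap.GAxis

end
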